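import Mathlib
import Summits.NavierStokesRegularity.FluidComputer.AbcClassIComplexBasesPrep
import Summits.NavierStokesRegularity.FluidComputer.AbcClassIIComplexBasesPairing

/-!
# GROUP-B END-TO-END ON THE MODEL, CLASS I — ARBITRARY COMPLEX (UNITARY) ORBIT BASES (prep 2):
# SECTION PAIRING of the complex first-order matrix `amc`
(profile-cert-3 g9, cell `ns-blowup`, 2026-08-27; the class-I twin of the cert-3 g8 class-II file of the same name — same statements and proofs over the class-I layer `AbcClassI*`)

HONEST FRAMING (human rulings D-0035/D-0074): nothing here is a claim about Navier–Stokes blow-up.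
WHAT THIS IS NOT: not NS evidence. MODEL lane (NS linearised about the forced ABC flow `abcFlow 1 1 1`,
class I); no certificate, number or census word moves. Sequel of `AbcClassIIComplexBasesPrep` (cert-3 g8:
for a family `wf` of complex orthonormal bases of the complexified class-I orbit spaces — supported on one
orbit, transversal, class I, `Σ_{k∈O} ⟪wf ⟨O,a⟩ k, wf ⟨O,b⟩ k⟫ = δ_ab` — the complex first-order matrix
`amc i j = Σ_k ⟪wf i k, Π_k X(wf j)(k)⟫` is `Qᴴ amat Q` on orbit-saturated index sets with `Q` column-
orthonormal). **`re_section_pairing_camc`** — the SECTION PAIRING input of the GROUP-B instantiation for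
`amc`, on every finite index set with `s = √2`, in the single-sum form
`Re Σ_i conj(c_i) Σ_j amc_ij c_j ≤ √2 Σ |c_i|²`: `c ↦ f = Q c` is an isometry on saturated sets and
`cᴴ amc c = fᴴ amat f`; then `AbcClassISections`' `section_pairing_amat` (the complex analogue of
cert-3 g7's `re_section_pairing_eam`). Mathlib + the files named; no new definitions. bears_on LADDER-NS
N5 / Z4-a(1) (F5 caveat (iii‴) for implementation 3). [folklore].
-/

noncomputable section

open scoped BigOperators ComplexConjugate InnerProductSpace Matrix
open Finset Matrix

namespace Summit.NavierStokesRegularity.FluidComputer.AbcClassIEigenpair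

open Literature.Analysis.FunctionSpaces Literature.Analysis.FunctionSpaces.Torus
open Literature.Analysis.FunctionSpaces.EuclideanSpace
open Literature.Analysis.FluidPDE Literature.Analysis.FluidPDE.SteadyLattice
open Summit.NavierStokesRegularity.FluidComputer.AbcClassI
open Summit.NavierStokesRegularity.FluidComputer.AbcClassII (Fam crossForm secOp rotR rotS sgnOrbit cube extend
  restrictTo Orbit toOrbit onormSq osupNorm cubeOrbits nbrOrbits mem_nbrOrbits mem_nbrOrbits_comm toOrbit_eq_iff
  mem_cubeOrbits onormSq_nonneg neg_mem_of_orbitClosed inner_eq_sum_extend extend_apply_of_mem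
  extend_apply_of_not_mem sq_osupNorm_le_onormSq kdot_cut sum_cube_filter_eq mem_sgnOrbit_self)

section ComplexBasesPairing

variable (wf : Idx → Fam)
variable (hws : ∀ i : Idx, ∀ k ∉ i.1.1, wf i k = 0)
variable (hwt : ∀ (i : Idx) (k : Fin 3 → ℤ), ∑ j : Fin 3, ((k j : ℤ) : ℂ) * wf i k j = 0)
variable (hwI : ∀ i : Idx, IsClassI (wf i))
variable (hwon : ∀ (O : Orbit) (a b : Fin (odim O)),
  ∑ k ∈ O.1, (inner ℂ (wf ⟨O, a⟩ k) (wf ⟨O, b⟩ k) : ℂ) = if a = b then 1 else 0)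
variable (amc : Idx → Idx → ℂ)
variable (hamc : ∀ i j : Idx, amc i j =
  ∑ k ∈ i.1.1, (inner ℂ (wf i k) (Torus.lerayCoeff k (crossForm 1 1 1 (wf j) k)) : ℂ))

include hws hwt hwI hwon hamc in
/-- **SECTION PAIRING in complex orbit bases**: for every finite index set `F` and complex coefficients,
`Re Σ_{i,j ∈ F} conj(c_i) amc_ij c_j ≤ √2 Σ_{i ∈ F} |c_i|²`. -/
theorem re_section_pairing_camc (F : Finset AbcClassI.Idx) (c : AbcClassI.Idx → ℂ) :
    RCLike.re (∑ i ∈ F, conj (c i) * ∑ j ∈ F, amc i j * c j) ≤ Real.sqrt 2 * ∑ i ∈ F, ‖c i‖ ^ 2 := by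
  classical
  -- the double-sum form
  have hds : ∑ i ∈ F, conj (c i) * ∑ j ∈ F, amc i j * c j =
      ∑ i ∈ F, ∑ j ∈ F, conj (c i) * amc i j * c j := by
    refine Finset.sum_congr rfl fun i _ => ?_
    rw [Finset.mul_sum]
    exact Finset.sum_congr rfl fun j _ => by ring
  rw [hds]
  -- saturate `F` to a cube and zero-pad the coefficients
  obtain ⟨n, hn⟩ : ∃ n, F ⊆ cubeIdx n :=
    ⟨F.sup fun i => osupNorm i.1, fun i hi =>
      mem_cubeIdx.mpr (Finset.le_sup (f := fun i : Idx => osupNorm i.1) hi)⟩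
  have hT : ∀ i ∈ cubeIdx n, ∀ a : Fin (odim i.1), (⟨i.1, a⟩ : Idx) ∈ cubeIdx n :=
    fun i hi a => cubeIdx_saturated n hi a
  set c' : Idx → ℂ := fun i => if i ∈ F then c i else 0 with hc'
  have hcF : ∀ i ∈ F, c' i = c i := fun i hi => by simp [hc', hi]
  have hc0 : ∀ i, i ∉ F → c' i = 0 := fun i hi => by simp [hc', hi]
  have e1 : ∑ i ∈ F, ∑ j ∈ F, conj (c i) * amc i j * c j =
      ∑ i ∈ cubeIdx n, ∑ j ∈ cubeIdx n, conj (c' i) * amc i j * c' j := by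
    rw [← Finset.sum_subset hn (fun i _ hi => by
      rw [Finset.sum_eq_zero fun j _ => by rw [hc0 i hi, map_zero, zero_mul, zero_mul]])]
    refine Finset.sum_congr rfl fun i hi => ?_
    rw [← Finset.sum_subset hn (fun j _ hj => by rw [hc0 j hj, mul_zero])]
    exact Finset.sum_congr rfl fun j hj => by rw [hcF i hi, hcF j hj]
  have e2 : ∑ i ∈ F, ‖c i‖ ^ 2 = ∑ i ∈ cubeIdx n, ‖c' i‖ ^ 2 := by
    rw [← Finset.sum_subset hn (fun j _ hj => by rw [hc0 j hj, norm_zero, zero_pow two_ne_zero])]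
    exact Finset.sum_congr rfl fun j hj => by rw [hcF j hj]
  rw [e1, e2]
  -- the change of coordinates `f = Q c'`
  set Q : Idx → Idx → ℂ := fun i j => ∑ k ∈ i.1.1, (inner ℂ (bfam i k) (wf j k) : ℂ) with hQ
  set f : Idx → ℂ := fun a => ∑ j ∈ cubeIdx n, Q a j * c' j with hf
  have ham' : ∀ i ∈ cubeIdx n, ∀ j ∈ cubeIdx n, amc i j =
      ∑ a ∈ cubeIdx n, ∑ a' ∈ cubeIdx n, conj (Q a i) * ((amat a a' : ℝ) : ℂ) * Q a' j := by
    intro i hi j hj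
    rw [camc_eq_sum wf hws hwt hwI amc hamc hT hT hi hj]
  -- step 1: for fixed `i`, `Σ_j amc_ij c'_j = Σ_a conj(Q_ai) Σ_a' amat_aa' f_a'`
  have step1 : ∀ i ∈ cubeIdx n, ∑ j ∈ cubeIdx n, amc i j * c' j =
      ∑ a ∈ cubeIdx n, conj (Q a i) * ∑ a' ∈ cubeIdx n, ((amat a a' : ℝ) : ℂ) * f a' := by
    intro i hi
    calc ∑ j ∈ cubeIdx n, amc i j * c' j
        = ∑ j ∈ cubeIdx n, ∑ a ∈ cubeIdx n, ∑ a' ∈ cubeIdx n,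
            conj (Q a i) * ((amat a a' : ℝ) : ℂ) * Q a' j * c' j := by
          refine Finset.sum_congr rfl fun j hj => ?_
          rw [ham' i hi j hj, Finset.sum_mul]
          refine Finset.sum_congr rfl fun a _ => ?_
          rw [Finset.sum_mul]
      _ = ∑ a ∈ cubeIdx n, ∑ a' ∈ cubeIdx n, ∑ j ∈ cubeIdx n,
            conj (Q a i) * ((amat a a' : ℝ) : ℂ) * Q a' j * c' j := by
          rw [Finset.sum_comm]
          exact Finset.sum_congr rfl fun a _ => Finset.sum_comm
      _ = ∑ a ∈ cubeIdx n, conj (Q a i) * ∑ a' ∈ cubeIdx n, ((amat a a' : ℝ) : ℂ) * f a' := by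
          refine Finset.sum_congr rfl fun a _ => ?_
          rw [Finset.mul_sum]
          refine Finset.sum_congr rfl fun a' _ => ?_
          rw [hf, Finset.mul_sum, Finset.mul_sum]
          exact Finset.sum_congr rfl fun j _ => by ring
  -- step 2: `Σ_i conj(c'_i) Σ_a conj(Q_ai) g_a = Σ_a conj(f_a) g_a`
  have hconjf : ∀ a, conj (f a) = ∑ i ∈ cubeIdx n, conj (Q a i) * conj (c' i) := fun a => by
    rw [hf, map_sum]
    exact Finset.sum_congr rfl fun i _ => by rw [map_mul]
  have step2 : ∑ i ∈ cubeIdx n, ∑ j ∈ cubeIdx n, conj (c' i) * amc i j * c' j =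
      ∑ a ∈ cubeIdx n, ∑ a' ∈ cubeIdx n, conj (f a) * ((amat a a' : ℝ) : ℂ) * f a' := by
    calc ∑ i ∈ cubeIdx n, ∑ j ∈ cubeIdx n, conj (c' i) * amc i j * c' j
        = ∑ i ∈ cubeIdx n, conj (c' i) * ∑ j ∈ cubeIdx n, amc i j * c' j := by
          refine Finset.sum_congr rfl fun i _ => ?_
          rw [Finset.mul_sum]
          exact Finset.sum_congr rfl fun j _ => by ring
      _ = ∑ i ∈ cubeIdx n, ∑ a ∈ cubeIdx n, conj (c' i) * (conj (Q a i) *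
            ∑ a' ∈ cubeIdx n, ((amat a a' : ℝ) : ℂ) * f a') := by
          refine Finset.sum_congr rfl fun i hi => ?_
          rw [step1 i hi, Finset.mul_sum]
      _ = ∑ a ∈ cubeIdx n, ∑ i ∈ cubeIdx n, conj (c' i) * (conj (Q a i) *
            ∑ a' ∈ cubeIdx n, ((amat a a' : ℝ) : ℂ) * f a') := Finset.sum_comm
      _ = ∑ a ∈ cubeIdx n, conj (f a) * ∑ a' ∈ cubeIdx n, ((amat a a' : ℝ) : ℂ) * f a' := by
          refine Finset.sum_congr rfl fun a _ => ?_
          rw [hconjf a, Finset.sum_mul]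
          exact Finset.sum_congr rfl fun i _ => by ring
      _ = ∑ a ∈ cubeIdx n, ∑ a' ∈ cubeIdx n, conj (f a) * ((amat a a' : ℝ) : ℂ) * f a' := by
          refine Finset.sum_congr rfl fun a _ => ?_
          rw [Finset.mul_sum]
          exact Finset.sum_congr rfl fun a' _ => by ring
  -- the isometry `Σ_a |f_a|² = Σ_i |c'_i|²`
  have hiso : ∑ a ∈ cubeIdx n, ‖f a‖ ^ 2 = ∑ i ∈ cubeIdx n, ‖c' i‖ ^ 2 := by
    have h1 : ∀ a, ((‖f a‖ ^ 2 : ℝ) : ℂ) = ∑ i ∈ cubeIdx n, ∑ i' ∈ cubeIdx n,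
        (conj (Q a i) * Q a i') * (conj (c' i) * c' i') := by
      intro a
      rw [← Complex.normSq_eq_norm_sq, ← Complex.mul_conj, mul_comm, hconjf a, hf, Finset.sum_mul]
      refine Finset.sum_congr rfl fun i _ => ?_
      rw [Finset.mul_sum]
      refine Finset.sum_congr rfl fun i' _ => ?_
      ring
    have h2 : ((∑ a ∈ cubeIdx n, ‖f a‖ ^ 2 : ℝ) : ℂ) = ((∑ i ∈ cubeIdx n, ‖c' i‖ ^ 2 : ℝ) : ℂ) := by
      push_cast
      calc ∑ a ∈ cubeIdx n, ((‖f a‖ : ℂ)) ^ 2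
          = ∑ a ∈ cubeIdx n, ∑ i ∈ cubeIdx n, ∑ i' ∈ cubeIdx n,
              (conj (Q a i) * Q a i') * (conj (c' i) * c' i') := by
            refine Finset.sum_congr rfl fun a _ => ?_
            rw [← h1 a]; push_cast; ring
        _ = ∑ i ∈ cubeIdx n, ∑ i' ∈ cubeIdx n, ∑ a ∈ cubeIdx n,
              (conj (Q a i) * Q a i') * (conj (c' i) * c' i') := by
            rw [Finset.sum_comm]
            exact Finset.sum_congr rfl fun i _ => Finset.sum_comm
        _ = ∑ i ∈ cubeIdx n, ∑ i' ∈ cubeIdx n,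
              (if i = i' then (1 : ℂ) else 0) * (conj (c' i) * c' i') := by
            refine Finset.sum_congr rfl fun i hi => Finset.sum_congr rfl fun i' hi' => ?_
            rw [← Finset.sum_mul, ← sum_cQ_cols wf hws hwt hwI hwon hT hi hi']
        _ = ∑ i ∈ cubeIdx n, ((‖c' i‖ : ℂ)) ^ 2 := by
            refine Finset.sum_congr rfl fun i hi => ?_
            rw [Finset.sum_eq_single i (fun i' _ hne => by rw [if_neg (Ne.symm hne)]; simp)
              (fun h => absurd hi h)]
            rw [if_pos rfl, mul_comm ((starRingEnd ℂ) (c' i)) (c' i), Complex.mul_conj,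
              Complex.normSq_eq_norm_sq]
            push_cast
            ring
    exact_mod_cast h2
  rw [step2, ← hiso]
  exact section_pairing_amat (cubeIdx n) f

end ComplexBasesPairing

end Summit.NavierStokesRegularity.FluidComputer.AbcClassIEigenpair

end
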